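import Mathlib
import HarnessLib
import Summits.HubbardSuperconductivity.HubbardSuperconductivity.Theorems.KLProgrammeKLRegimeVolumeLimitNestedCarrierRate
import Summits.HubbardSuperconductivity.HubbardSuperconductivity.Theorems.KLProgrammeKLRegimeVolumeLimitNestedPoisson

/-!
# VL child `KLRegimeVolumeLimitV14` (stmt-HubbardSuperconductivity-19921), «cauchy» v3 (d43a8bd19247ce15): the registered `stub_vl_carrierRate`
# FROM POSITION-SPACE DATA — periodisation comparability on nested tori + a first site moment of the bare last-scale carrier's site kernel
# (cell gate-hubbard-kl, seat hubbard-kl-k3c5-p3 g5, technique «OS-positivity-free direct assembly»; `--supports` 19921)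

At fixed cutoff `M` and Matsubara label `ω`, the bare last-scale self-energy `k ↦ Σ̂⁰_{L,M}(ω,k) := klSelfEnergy L M β U μ 0 klE0 (nScales β+1) (ω,k) 0` is a
function on the momentum grid of the `L`-torus, hence the discrete Fourier transform of its SITE KERNEL `s_{L,M,ω} := torusFourierInv (Σ̂⁰_{L,M}(ω,·))`
(Fourier inversion).  By `…VolumeLimitNestedPoisson` (Poisson on nested tori; momentum modulus from the first centred site moment) the two hypotheses of
`stub_vl_carrierRate_of_nested` (p499369) — (N) nested same-momentum comparability, (M) a one-volume momentum modulus — follow from POSITION-SPACE data: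

* `stub_vl_carrierRate_of_sitePeriodisation` — **the registered `stub_vl_carrierRate` text VERBATIM** from, under the stub's binder prefix,
  (S) `∃ L₀ ρ → 0`: for `L₀ ≤ L`, `L″ = b·L`, `∃ M₀ ∀ M ≥ M₀ ∀ ω`, `Σ_{y ∈ Λ_L} ‖s_{L,M,ω}(y) − Σ_{x ≡ y (mod L)} s_{L″,M,ω}(x)‖ ≤ ρ L` (the torus-`L` site kernel
      against the PERIODISED torus-`L″` site kernel at the same cutoff and label), and
  (D) `∃ L₀ D`: for `L₀ ≤ L`, `∃ M₀ ∀ M ≥ M₀ ∀ ω`, `Σ_{z ∈ Λ_L} ‖z̃‖₁ ‖s_{L,M,ω}(z)‖ ≤ D` (an `L`-uniform first centred site moment).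
This is the shape a position-space two-volume pass of the expansion delivers (kernels against periodised kernels; decay in the torus distance).

Everything is proved; no definition (the site kernel is written inline as `torusFourierInv`); nothing is asserted about the model.
-/

noncomputable section

namespace Summit.HubbardSuperconductivity.HubbardSuperconductivity.Theorems.TwoPointAssembly

set_option linter.dupNamespace false -- summit = problem name (single-conjunct summit), D-0017

open Finset Filter Topology Literature.MathematicalPhysics.QuantumLattice Literature.Probability.LatticeModels
open Literature.MathematicalPhysics.QuantumLattice.FermiRG
open Summit.HubbardSuperconductivity.HubbardSuperconductivity.Theorems.DispersionFlow
open Summit.HubbardSuperconductivity.HubbardSuperconductivity.Theorems.KLRegimeSplit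
open Summit.HubbardSuperconductivity.HubbardSuperconductivity.Theorems.KLProgrammeLegKernels

/-- A grid function IS the discrete Fourier transform of its site kernel `torusFourierInv f` (Fourier inversion, second form). [folklore] -/
theorem eq_torusFourier_torusFourierInv {d L : ℕ} [NeZero L] (f : TorusSite d L → ℂ) (k : TorusSite d L) :
    f k = torusFourier (torusFourierInv f) k := by
  rw [torusFourier_torusFourierInv_holds (d := d) (L := L) f]

/-- **`stub_vl_carrierRate` (stmt-…-19921, «cauchy» v3) FROM POSITION-SPACE DATA ON NESTED TORI.**  With the site kernel of the bare last-scale carrier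
`s_{L,M,ω} := torusFourierInv (k ↦ klSelfEnergy L M β U μ 0 klE0 (nScales β+1) (ω,k) 0)` (written inline): IF for every datum of the registered stub
(S) `∃ L₀ ρ → 0`: for `L₀ ≤ L` and `L″ = b·L`, `∃ M₀ ∀ M ≥ M₀ ∀ ω`, `Σ_y ‖s_{L,M,ω}(y) − Σ_{x ≡ y (mod L)} s_{L″,M,ω}(x)‖ ≤ ρ L`, and
(D) `∃ L₀ D`: for `L₀ ≤ L`, `∃ M₀ ∀ M ≥ M₀ ∀ ω`, `Σ_z ‖z̃‖₁ ‖s_{L,M,ω}(z)‖ ≤ D`, THEN the registered text of `stub_vl_carrierRate` holds verbatim. -/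
theorem stub_vl_carrierRate_of_sitePeriodisation
    (hS : ∀ (G : GeoConsts) (P : SplitConsts) (Q : EngConsts) (R : RenConsts), G.WF → P.WF → Q.WF → R.WF →
      ∃ c₅ : ℝ, 0 < c₅ ∧ ∀ c : ℝ, 0 < c → c ≤ c₅ → ∃ U₀ : ℝ, 0 < U₀ ∧
        ∀ μ ∈ klWindowC, ∀ U : ℝ, 0 < U → U ≤ U₀ → ∀ β : ℝ, klBetaMin ≤ β → β ≤ Real.exp (c / U ^ 2) →
          ∀ K : TrigPolyC4v, klPredsV14.frameOK R U (nScales β) μ K →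
            ∀ (Lstar : ℕ) (Mstar : ℕ → ℕ), TowerP klPredsV14 G P Q R β U μ K Lstar Mstar →
              ∃ L₀ : ℕ, ∃ ρ : ℕ → ℝ, Tendsto ρ atTop (𝓝 0) ∧
                ∀ (L : ℕ) [NeZero L], L₀ ≤ L → ∀ (L'' : ℕ) [NeZero L''] (b : ℕ), L'' = b * L → ∃ M₀ : ℕ, ∀ (M : ℕ) [NeZero M], M₀ ≤ M →
                  ∀ ω : MatsubaraIdx M,
                    ∑ y : TorusSite 2 L,
                      ‖torusFourierInv (fun k : TorusSite 2 L => klSelfEnergy L M β U μ 0 klE0 (nScales β + 1) (ω, k) 0) y -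
                        ∑ x ∈ Finset.univ.filter (fun x : TorusSite 2 L'' => (fun i => (((x i).val : ℕ) : ZMod L)) = y),
                          torusFourierInv (fun k : TorusSite 2 L'' => klSelfEnergy L'' M β U μ 0 klE0 (nScales β + 1) (ω, k) 0) x‖ ≤ ρ L)
    (hD : ∀ (G : GeoConsts) (P : SplitConsts) (Q : EngConsts) (R : RenConsts), G.WF → P.WF → Q.WF → R.WF →
      ∃ c₅ : ℝ, 0 < c₅ ∧ ∀ c : ℝ, 0 < c → c ≤ c₅ → ∃ U₀ : ℝ, 0 < U₀ ∧
        ∀ μ ∈ klWindowC, ∀ U : ℝ, 0 < U → U ≤ U₀ → ∀ β : ℝ, klBetaMin ≤ β → β ≤ Real.exp (c / U ^ 2) →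
          ∀ K : TrigPolyC4v, klPredsV14.frameOK R U (nScales β) μ K →
            ∀ (Lstar : ℕ) (Mstar : ℕ → ℕ), TowerP klPredsV14 G P Q R β U μ K Lstar Mstar →
              ∃ L₀ : ℕ, ∃ D : ℝ, ∀ (L : ℕ) [NeZero L], L₀ ≤ L → ∃ M₀ : ℕ, ∀ (M : ℕ) [NeZero M], M₀ ≤ M → ∀ ω : MatsubaraIdx M,
                ∑ z : TorusSite 2 L, (∑ i, |(Torus.cRepZ (z i) : ℝ)|) *
                  ‖torusFourierInv (fun k : TorusSite 2 L => klSelfEnergy L M β U μ 0 klE0 (nScales β + 1) (ω, k) 0) z‖ ≤ D) :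
    ∀ (G : GeoConsts) (P : SplitConsts) (Q : EngConsts) (R : RenConsts), G.WF → P.WF → Q.WF → R.WF →
      ∃ c₅ : ℝ, 0 < c₅ ∧ ∀ c : ℝ, 0 < c → c ≤ c₅ → ∃ U₀ : ℝ, 0 < U₀ ∧
        ∀ μ ∈ klWindowC, ∀ U : ℝ, 0 < U → U ≤ U₀ → ∀ β : ℝ, klBetaMin ≤ β → β ≤ Real.exp (c / U ^ 2) →
          ∀ K : TrigPolyC4v, klPredsV14.frameOK R U (nScales β) μ K →
            ∀ (Lstar : ℕ) (Mstar : ℕ → ℕ), TowerP klPredsV14 G P Q R β U μ K Lstar Mstar →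
              ∃ L₀ : ℕ, ∃ D : ℝ, ∃ ρ : ℕ → ℝ, Tendsto ρ atTop (𝓝 0) ∧
                ∀ (L : ℕ) [NeZero L], L₀ ≤ L → ∀ (L' : ℕ) [NeZero L'], L ≤ L' → ∃ M₀ : ℕ, ∀ (M : ℕ) [NeZero M], M₀ ≤ M →
                  ∀ (ω : MatsubaraIdx M) (k : TorusSite 2 L) (k' : TorusSite 2 L'),
                    ‖klSelfEnergy L M β U μ 0 klE0 (nScales β + 1) (ω, k) 0 -
                        klSelfEnergy L' M β U μ 0 klE0 (nScales β + 1) (ω, k') 0‖ ≤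
                      ρ L + D * ∑ i, torusAbs (latticeMomentum L k i - latticeMomentum L' k' i) := by
  refine stub_vl_carrierRate_of_nested ?_ ?_
  · -- (N) from (S): Poisson on nested tori
    intro G P Q R hG hP hQ hR
    obtain ⟨c₅, hc₅, hc⟩ := hS G P Q R hG hP hQ hR
    refine ⟨c₅, hc₅, fun c hc0 hcc => ?_⟩
    obtain ⟨U₀, hU₀, hU⟩ := hc c hc0 hcc
    refine ⟨U₀, hU₀, fun μ hμ U hU0 hUU β hβmin hβmax K hK Lstar Mstar hT => ?_⟩
    obtain ⟨L₀, ρ, hρ, hper⟩ := hU μ hμ U hU0 hUU β hβmin hβmax K hK Lstar Mstar hT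
    refine ⟨L₀, ρ, hρ, fun L _ hL L'' _ hdvd => ?_⟩
    obtain ⟨b, hb⟩ := hdvd
    have hM : L'' = b * L := hb.trans (mul_comm _ _)
    obtain ⟨M₀, hM₀⟩ := hper L hL L'' b hM
    refine ⟨M₀, fun M _ hMM ω k k'' hkk => ?_⟩
    rw [eq_torusFourier_torusFourierInv (fun k : TorusSite 2 L => klSelfEnergy L M β U μ 0 klE0 (nScales β + 1) (ω, k) 0) k,
      eq_torusFourier_torusFourierInv (fun k : TorusSite 2 L'' => klSelfEnergy L'' M β U μ 0 klE0 (nScales β + 1) (ω, k) 0) k'']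
    exact (norm_torusFourier_sub_torusFourier_of_latticeMomentum_eq hM _ _ hkk).trans (hM₀ M hMM ω)
  · -- (M) from (D): the first centred site moment (no slack)
    intro G P Q R hG hP hQ hR
    obtain ⟨c₅, hc₅, hc⟩ := hD G P Q R hG hP hQ hR
    refine ⟨c₅, hc₅, fun c hc0 hcc => ?_⟩
    obtain ⟨U₀, hU₀, hU⟩ := hc c hc0 hcc
    refine ⟨U₀, hU₀, fun μ hμ U hU0 hUU β hβmin hβmax K hK Lstar Mstar hT => ?_⟩
    obtain ⟨L₀, D, hmom⟩ := hU μ hμ U hU0 hUU β hβmin hβmax K hK Lstar Mstar hT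
    refine ⟨L₀, D, fun _ => 0, tendsto_const_nhds, fun L _ hL => ?_⟩
    obtain ⟨M₀, hM₀⟩ := hmom L hL
    refine ⟨M₀, fun M _ hMM ω k₁ k₂ => ?_⟩
    rw [zero_add, eq_torusFourier_torusFourierInv (fun k : TorusSite 2 L => klSelfEnergy L M β U μ 0 klE0 (nScales β + 1) (ω, k) 0) k₁,
      eq_torusFourier_torusFourierInv (fun k : TorusSite 2 L => klSelfEnergy L M β U μ 0 klE0 (nScales β + 1) (ω, k) 0) k₂]
    refine (norm_torusFourier_sub_torusFourier_le_firstMoment _ k₁ k₂).trans ?_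
    exact mul_le_mul_of_nonneg_right (hM₀ M hMM ω) (klvc_tmod_nonneg _ _)

end Summit.HubbardSuperconductivity.HubbardSuperconductivity.Theorems.TwoPointAssembly

end
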